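import Literature.MathematicalPhysics.QuantumLattice.HeisenbergWindowCertificateSquare
import Literature.MathematicalPhysics.QuantumLattice.BlockProductStates
import Literature.MathematicalPhysics.QuantumLattice.SpinHalfCasimirBound
import Literature.MathematicalPhysics.QuantumLattice.SpinChainsSpinSystemProofs
import HarnessLib

/-!
# Subadditivity of the ground-state energy of the Heisenberg antiferromagnet on tori

Topic `MathematicalPhysics/QuantumLattice`; the spin-system counterpart of the Hubbard files
`HubbardRectangularTorus.lean` / `HubbardTorus2DTiling.lean` (Ruelle-type cuts of tori), written for
the thermodynamic limit of the ground-state energy density of the spin-`n/2` Heisenberg model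
`H_L = J Σ_{⟨xy⟩} 𝐒_x·𝐒_y` on the tori `(ℤ/Lℤ)^d` (`heisenbergHamiltonian n (torusGraph d L) J`,
`HeisenbergModel.lean`), proved in `HeisenbergEnergyDensity.lean`. Everything here is finite-volume
and PROVED; the two trial states are written in the configuration basis (`SpinSystem.lean`):

* **Exchange bounds** (`re_expect_spinDot_le`, `neg_re_expect_spinDot_le`): for two spins `n/2` at
  sites `x ≠ y`, `|Re⟨v, 𝐒_x·𝐒_y v⟩| ≤ S(S+1)‖v‖²` (`S = n/2`, `casimirValue n = S(S+1)`), from the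
  sums of Hermitian squares `Σ_α (Sᵅ_x ± Sᵅ_y)² = 2(S(S+1) ± 𝐒_x·𝐒_y)` (one-site Casimir
  `sum_siteSpin_mul_siteSpin_holds`); the **a priori bound** `E₀(H_L) ≥ -J S(S+1) d L^d` (`J ≥ 0`, `L ≥ 3`;
  `heisenbergTorus_groundEnergy_ge`).
* **Tiling** (`heisenbergTorus_groundEnergy_tiling`): for `M ≥ 3`, `k ≥ 1`, `J ≥ 0`,
  `E₀(H_{kM}) ≤ k^d (E₀(H_M) + 2 J S(S+1) d M^{d-1})` — the block product state `⨂_{blocks} φ_M`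
  (`BlockProductStates.lean`, along the block decomposition `HeisenbergTL.torusBlockDecomp :
  (ℤ/kMℤ)^d ≃ (ℤ/kℤ)^d × (ℤ/Mℤ)^d`) of the ground state `φ_M` of the `M`-torus is a trial state; a
  bond inside a block has its block value (`blockProductState_expect_onSite_onSite_same`), each of the
  `≤ d M^{d-1}` boundary pairs per block costs at most `2 S(S+1)`.
* **Filling** (`heisenbergTorus_groundEnergy_filling`): for `3 ≤ ℓ ≤ L`, `J ≥ 0`,
  `E₀(H_L) ≤ E₀(H_ℓ) + J S(S+1) d (2ℓ^{d-1} + L^d - ℓ^d)` — the ground state of the `ℓ`-torus placed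
  on the sub-box `{0,…,ℓ-1}^d ⊂ (ℤ/Lℤ)^d` (`HeisenbergTL.torusCast`) and extended by the reference
  configuration `|0…0⟩` outside (`HeisenbergTL.extendState`) is a trial state.

These are the three hypotheses of Fekete's lemma along `d`-th powers
(`HeisenbergEnergyDensity.lean`). Standard material: D. Ruelle, *Statistical Mechanics* (1969),
§2.2 (thermodynamic limit of lattice systems by cutting boxes); P. W. Anderson, Phys. Rev. 83 (1951)
1260 (product trial states); H. Tasaki, *Physics and Mathematics of Quantum Many-Body Systems*
(2020), §2.1–2.2, §2.4 (spin operators, tensor products in the `σ`-basis, the two-spin problem).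
No named facts; the definitions are the bookkeeping maps (`casimirValue`, `HeisenbergTL.zmodBlock`,
`zmodPos`, `zmodBlockGlue`, `torusBlockDecomp`, `extendState`, `torusCast`).
-/

noncomputable section

open Matrix Complex Finset Filter Topology Literature.Probability.LatticeModels
open scoped ComplexOrder BigOperators

namespace Literature.MathematicalPhysics.QuantumLattice

/-! ### Exchange bounds for two spins `n/2` -/

section BondBounds

variable {Λ : Type*} [Fintype Λ] [DecidableEq Λ]

/-- The Casimir value `S(S+1)` of spin `S = n/2`, as a real number: the scale of the exchange bounds
`-S(S+1) ≤ 𝐒_x·𝐒_y ≤ S(S+1)` for two spins `n/2`. Tasaki (2020) §2.1, eq. (2.1.2). [folklore] -/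
def casimirValue (n : ℕ) : ℝ := (n : ℝ) / 2 * ((n : ℝ) / 2 + 1)

/-- `S(S+1) ≥ 0`. [folklore] -/
theorem casimirValue_nonneg (n : ℕ) : 0 ≤ casimirValue n := by
  unfold casimirValue; positivity

/-- **The one-site Casimir in a spin system**, real-coefficient form: `Σ_α Sᵅ_x Sᵅ_x = S(S+1)·1`
(`S = n/2`; the tree's named fact `sum_siteSpin_mul_siteSpin`, discharged by
`sum_siteSpin_mul_siteSpin_holds` in `SpinChainsSpinSystemProofs.lean`). Tasaki (2020) §2.1,
eq. (2.1.2). [folklore] -/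
theorem sum_siteSpin_mul_siteSpin_casimirValue (n : ℕ) (x : Λ) :
    ∑ α : Fin 3, siteSpin n x α * siteSpin n x α =
      ((casimirValue n : ℝ) : ℂ) • (1 : Op Λ (n + 1)) := by
  rw [sum_siteSpin_mul_siteSpin_holds n x]
  congr 1
  unfold casimirValue
  push_cast
  ring

/-- `⟨v, (Aᴴ A) v⟩ = ⟨A v, A v⟩`. [folklore] -/
private theorem star_dotProduct_conjTranspose_mul_self_mulVec_aux {m : Type*} [Fintype m] (A : Matrix m m ℂ)
    (v : m → ℂ) : star v ⬝ᵥ ((Aᴴ * A) *ᵥ v) = star (A *ᵥ v) ⬝ᵥ (A *ᵥ v) := by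
  rw [← mulVec_mulVec, star_mulVec, ← dotProduct_mulVec]

/-- The sum-of-squares identities behind the exchange bounds: for `x ≠ y`,
`Σ_α (Sᵅ_x ± Sᵅ_y)² = 2(S(S+1)·1 ± 𝐒_x·𝐒_y)`. [folklore] -/
theorem sum_siteSpin_add_mul_self (n : ℕ) {x y : Λ} (hxy : x ≠ y) :
    ∑ α : Fin 3, (siteSpin n x α + siteSpin n y α) * (siteSpin n x α + siteSpin n y α) =
      (2 : ℂ) • (((casimirValue n : ℝ) : ℂ) • (1 : Op Λ (n + 1)) + spinDot n x y) := by
  have hexp : ∀ α : Fin 3, (siteSpin n x α + siteSpin n y α) * (siteSpin n x α + siteSpin n y α) =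
      siteSpin n x α * siteSpin n x α + siteSpin n y α * siteSpin n y α +
        (2 : ℂ) • (siteSpin n x α * siteSpin n y α) := by
    intro α
    have hc := (siteSpin_commute_of_ne_holds n hxy α α).eq
    rw [add_mul, mul_add, mul_add, ← hc, two_smul]
    abel
  simp only [hexp, Finset.sum_add_distrib, ← Finset.smul_sum]
  rw [sum_siteSpin_mul_siteSpin_casimirValue, sum_siteSpin_mul_siteSpin_casimirValue,
    ← spinDot_eq_sum_mul_of_ne n hxy]
  module

/-- `Σ_α (Sᵅ_x - Sᵅ_y)² = 2(S(S+1)·1 - 𝐒_x·𝐒_y)` for `x ≠ y`. [folklore] -/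
theorem sum_siteSpin_sub_mul_self (n : ℕ) {x y : Λ} (hxy : x ≠ y) :
    ∑ α : Fin 3, (siteSpin n x α - siteSpin n y α) * (siteSpin n x α - siteSpin n y α) =
      (2 : ℂ) • (((casimirValue n : ℝ) : ℂ) • (1 : Op Λ (n + 1)) - spinDot n x y) := by
  have hexp : ∀ α : Fin 3, (siteSpin n x α - siteSpin n y α) * (siteSpin n x α - siteSpin n y α) =
      siteSpin n x α * siteSpin n x α + siteSpin n y α * siteSpin n y α -
        (2 : ℂ) • (siteSpin n x α * siteSpin n y α) := by
    intro α
    have hc := (siteSpin_commute_of_ne_holds n hxy α α).eq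
    rw [sub_mul, mul_sub, mul_sub, ← hc, two_smul]
    abel
  simp only [hexp, Finset.sum_sub_distrib, Finset.sum_add_distrib, ← Finset.smul_sum]
  rw [sum_siteSpin_mul_siteSpin_casimirValue, sum_siteSpin_mul_siteSpin_casimirValue,
    ← spinDot_eq_sum_mul_of_ne n hxy]
  module

/-- **Exchange bounds** `-S(S+1) ≤ 𝐒_x·𝐒_y ≤ S(S+1)` in quadratic-form shape: for `x ≠ y` and
every vector `v`, `|Re ⟨v, 𝐒_x·𝐒_y v⟩| ≤ S(S+1) Re ⟨v, v⟩` (from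
`2(S(S+1) ± 𝐒_x·𝐒_y) = Σ_α (Sᵅ_x ± Sᵅ_y)²` and `⟨v, T² v⟩ = ‖T v‖² ≥ 0` for Hermitian `T`).
Tasaki (2020) §2.4 (the two-spin problem). [folklore] -/
theorem re_expect_spinDot_le (n : ℕ) {x y : Λ} (hxy : x ≠ y) (v : TensorIndex Λ (n + 1) → ℂ) :
    (star v ⬝ᵥ (spinDot n x y *ᵥ v)).re ≤ casimirValue n * (star v ⬝ᵥ v).re := by
  -- `0 ≤ Σ_α ⟨v, (S_x - S_y)² v⟩ = 2 (c ⟨v,v⟩ - ⟨v, S·S v⟩)`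
  have hT : ∀ α : Fin 3, (siteSpin n x α - siteSpin n y α : Op Λ (n + 1))ᴴ =
      siteSpin n x α - siteSpin n y α := fun α => by
    rw [conjTranspose_sub, (siteSpin_isHermitian n x α).eq, (siteSpin_isHermitian n y α).eq]
  have hpos : ∀ α : Fin 3, 0 ≤ (star v ⬝ᵥ (((siteSpin n x α - siteSpin n y α) *
      (siteSpin n x α - siteSpin n y α)) *ᵥ v)).re := by
    intro α
    nth_rewrite 1 [← hT α]
    rw [star_dotProduct_conjTranspose_mul_self_mulVec_aux]
    exact (Complex.nonneg_iff.mp (dotProduct_star_self_nonneg _)).1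
  have hsum := Finset.sum_nonneg fun α (_ : α ∈ (Finset.univ : Finset (Fin 3))) => hpos α
  rw [← Complex.re_sum, ← dotProduct_sum, ← Matrix.sum_mulVec, sum_siteSpin_sub_mul_self n hxy,
    Matrix.smul_mulVec, dotProduct_smul, Matrix.sub_mulVec, dotProduct_sub, Matrix.smul_mulVec,
    dotProduct_smul, Matrix.one_mulVec] at hsum
  simp only [smul_eq_mul, Complex.mul_re, Complex.sub_re, Complex.sub_im, Complex.ofReal_re,
    Complex.ofReal_im, zero_mul, sub_zero] at hsum
  norm_num at hsum
  linarith

/-- The lower exchange bound `-S(S+1) Re⟨v,v⟩ ≤ Re⟨v, 𝐒_x·𝐒_y v⟩` (`x ≠ y`). Tasaki (2020) §2.4.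
[folklore] -/
theorem neg_re_expect_spinDot_le (n : ℕ) {x y : Λ} (hxy : x ≠ y) (v : TensorIndex Λ (n + 1) → ℂ) :
    -(casimirValue n * (star v ⬝ᵥ v).re) ≤ (star v ⬝ᵥ (spinDot n x y *ᵥ v)).re := by
  have hT : ∀ α : Fin 3, (siteSpin n x α + siteSpin n y α : Op Λ (n + 1))ᴴ =
      siteSpin n x α + siteSpin n y α := fun α => by
    rw [conjTranspose_add, (siteSpin_isHermitian n x α).eq, (siteSpin_isHermitian n y α).eq]
  have hpos : ∀ α : Fin 3, 0 ≤ (star v ⬝ᵥ (((siteSpin n x α + siteSpin n y α) *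
      (siteSpin n x α + siteSpin n y α)) *ᵥ v)).re := by
    intro α
    nth_rewrite 1 [← hT α]
    rw [star_dotProduct_conjTranspose_mul_self_mulVec_aux]
    exact (Complex.nonneg_iff.mp (dotProduct_star_self_nonneg _)).1
  have hsum := Finset.sum_nonneg fun α (_ : α ∈ (Finset.univ : Finset (Fin 3))) => hpos α
  rw [← Complex.re_sum, ← dotProduct_sum, ← Matrix.sum_mulVec, sum_siteSpin_add_mul_self n hxy,
    Matrix.smul_mulVec, dotProduct_smul, Matrix.add_mulVec, dotProduct_add, Matrix.smul_mulVec,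
    dotProduct_smul, Matrix.one_mulVec] at hsum
  simp only [smul_eq_mul, Complex.mul_re, Complex.add_re, Complex.add_im, Complex.ofReal_re,
    Complex.ofReal_im, zero_mul, sub_zero] at hsum
  norm_num at hsum
  linarith

/-- `|Re ⟨v, 𝐒_x·𝐒_y v⟩| ≤ S(S+1) Re⟨v,v⟩` (`x ≠ y`). [folklore] -/
theorem abs_re_expect_spinDot_le (n : ℕ) {x y : Λ} (hxy : x ≠ y) (v : TensorIndex Λ (n + 1) → ℂ) :
    |(star v ⬝ᵥ (spinDot n x y *ᵥ v)).re| ≤ casimirValue n * (star v ⬝ᵥ v).re :=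
  abs_le.2 ⟨neg_re_expect_spinDot_le n hxy v, re_expect_spinDot_le n hxy v⟩

end BondBounds

/-! ### The energy of the torus as a sum over bonds -/

section TorusEnergy

variable {d L : ℕ} [NeZero L]

/-- `⟨ψ, H_L ψ⟩ = J Σ_x Σᵢ ⟨ψ, 𝐒_x·𝐒_{x+eᵢ} ψ⟩` on the torus `(ℤ/Lℤ)^d`, `L ≥ 3`. [folklore] -/
theorem re_expect_heisenbergHamiltonian_torus (n : ℕ) (hL : 3 ≤ L) (J : ℝ)
    (ψ : TensorIndex (TorusSite d L) (n + 1) → ℂ) :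
    (star ψ ⬝ᵥ (heisenbergHamiltonian n (torusGraph d L) J *ᵥ ψ)).re =
      J * ∑ x : TorusSite d L, ∑ i : Fin d,
        (star ψ ⬝ᵥ (spinDot n x (x + Pi.single i 1) *ᵥ ψ)).re := by
  rw [heisenbergHamiltonian_torusGraph_eq_sum_spinDot n hL J, Matrix.smul_mulVec, dotProduct_smul,
    Matrix.sum_mulVec, dotProduct_sum]
  simp only [Matrix.sum_mulVec, dotProduct_sum, smul_eq_mul, Complex.re_ofReal_mul, Complex.re_sum]

omit [NeZero L] in
/-- The sites `x` and `x + eᵢ` of `(ℤ/Lℤ)^d` are distinct for `L ≥ 2`. [folklore] -/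
theorem torusSite_ne_add_single (hL : 2 ≤ L) (x : TorusSite d L) (i : Fin d) : x ≠ x + Pi.single i 1 := by
  intro h
  exact single_ne_zero_of_two_le L hL i (by simpa using h.symm)

/-- **A priori lower bound**: `E₀(H_L) ≥ -J S(S+1) d L^d` for `J ≥ 0`, `L ≥ 3` (every one of the
`d L^d` bonds is `≥ -S(S+1)`). [folklore] -/
theorem heisenbergTorus_groundEnergy_ge (n : ℕ) (hL : 3 ≤ L) {J : ℝ} (hJ : 0 ≤ J) :
    -(J * casimirValue n * d * (L : ℝ) ^ d) ≤
      (heisenbergHamiltonian n (torusGraph d L) J).groundEnergy := by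
  haveI : Nonempty (TensorIndex (TorusSite d L) (n + 1)) := ⟨fun _ => 0⟩
  have hH := heisenbergHamiltonian_isHermitian (Λ := TorusSite d L) n (torusGraph d L) J
  -- a normalised ground-state vector
  obtain ⟨v, hvmem, hv0⟩ := Submodule.exists_mem_ne_zero_of_ne_bot
    (Matrix.groundSpace_ne_bot_holds hH)
  obtain ⟨c, -, -, hc1⟩ := EigenvalueContinuation.exists_normalize hv0
  set ψ : TensorIndex (TorusSite d L) (n + 1) → ℂ := (c : ℂ) • v with hψ
  have hψmem : ψ ∈ (heisenbergHamiltonian n (torusGraph d L) J).groundSpace :=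
    Submodule.smul_mem _ _ hvmem
  have hE : (star ψ ⬝ᵥ (heisenbergHamiltonian n (torusGraph d L) J *ᵥ ψ)).re =
      (heisenbergHamiltonian n (torusGraph d L) J).groundEnergy :=
    (Matrix.rayleigh_eq_groundEnergy_iff_holds hH ψ hc1).2 hψmem
  rw [← hE, re_expect_heisenbergHamiltonian_torus n hL J ψ]
  have hcard : Fintype.card (TorusSite d L) = L ^ d := by
    rw [Fintype.card_pi]
    simp [ZMod.card, Finset.prod_const]
  have hbond : ∀ (x : TorusSite d L) (i : Fin d),
      -casimirValue n ≤ (star ψ ⬝ᵥ (spinDot n x (x + Pi.single i 1) *ᵥ ψ)).re := by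
    intro x i
    have h := neg_re_expect_spinDot_le n (torusSite_ne_add_single (by omega) x i) ψ
    rw [hc1, Complex.one_re, mul_one] at h
    exact h
  have hsum : -(casimirValue n * d * (L : ℝ) ^ d) ≤
      ∑ x : TorusSite d L, ∑ i : Fin d, (star ψ ⬝ᵥ (spinDot n x (x + Pi.single i 1) *ᵥ ψ)).re := by
    have h1 : ∑ x : TorusSite d L, ∑ i : Fin d, (-casimirValue n) ≤
        ∑ x : TorusSite d L, ∑ i : Fin d, (star ψ ⬝ᵥ (spinDot n x (x + Pi.single i 1) *ᵥ ψ)).re :=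
      Finset.sum_le_sum fun x _ => Finset.sum_le_sum fun i _ => hbond x i
    simp only [Finset.sum_const, Finset.card_univ, Fintype.card_fin, hcard, nsmul_eq_mul] at h1
    push_cast at h1
    linarith
  nlinarith [hsum, hJ]

end TorusEnergy

/-! ### Blocks of side `M` in the torus of side `kM` -/

namespace HeisenbergTL

section ZModBlocks

variable (k M : ℕ)

/-- The block coordinate `⌊z/M⌋ ∈ ℤ/kℤ` of `z ∈ ℤ/kMℤ`. [folklore] -/
def zmodBlock (z : ZMod (k * M)) : ZMod k := ((z.val / M : ℕ) : ZMod k)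

/-- The position `z mod M ∈ ℤ/Mℤ` of `z ∈ ℤ/kMℤ` inside its block (a ring homomorphism, `M ∣ kM`).
[folklore] -/
def zmodPos : ZMod (k * M) →+* ZMod M := ZMod.castHom (dvd_mul_left M k) (ZMod M)

/-- Gluing a block coordinate `b` and a position `f` to `bM + f ∈ ℤ/kMℤ`. [folklore] -/
def zmodBlockGlue (b : ZMod k) (f : ZMod M) : ZMod (k * M) := ((b.val * M + f.val : ℕ) : ZMod (k * M))

variable {k M} [NeZero k] [NeZero M]

/-- The position is the remainder: `(z mod M).val = z.val % M`. [folklore] -/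
theorem zmodPos_val (z : ZMod (k * M)) : (zmodPos k M z).val = z.val % M := by
  rw [zmodPos, ZMod.castHom_apply, ZMod.cast_eq_val, ZMod.val_natCast]

/-- The block is the quotient: `⌊z/M⌋.val = z.val / M`. [folklore] -/
theorem zmodBlock_val (z : ZMod (k * M)) : (zmodBlock k M z).val = z.val / M := by
  have hz : z.val < k * M := ZMod.val_lt z
  have hM : 0 < M := Nat.pos_of_ne_zero (NeZero.ne M)
  rw [zmodBlock, ZMod.val_cast_of_lt]
  exact Nat.div_lt_of_lt_mul (lt_of_lt_of_eq hz (Nat.mul_comm k M))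

/-- The value of the glued coordinate is `bM + f`. [folklore] -/
theorem val_zmodBlockGlue (b : ZMod k) (f : ZMod M) :
    (zmodBlockGlue k M b f).val = b.val * M + f.val := by
  have hb : b.val < k := ZMod.val_lt b
  have hf : f.val < M := ZMod.val_lt f
  have h : b.val * M + f.val < k * M := by
    have : (b.val + 1) * M ≤ k * M := Nat.mul_le_mul_right M hb
    nlinarith
  rw [zmodBlockGlue, ZMod.val_cast_of_lt h]

/-- `M⌊z/M⌋ + (z mod M) = z`. [folklore] -/
theorem zmodBlockGlue_block_pos (z : ZMod (k * M)) :
    zmodBlockGlue k M (zmodBlock k M z) (zmodPos k M z) = z := by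
  rw [zmodBlockGlue, zmodBlock_val, zmodPos_val, Nat.div_add_mod', ZMod.natCast_zmod_val]

/-- `⌊(bM + f)/M⌋ = b`. [folklore] -/
theorem zmodBlock_glue (b : ZMod k) (f : ZMod M) : zmodBlock k M (zmodBlockGlue k M b f) = b := by
  have hf : f.val < M := ZMod.val_lt f
  have hM : 0 < M := Nat.pos_of_ne_zero (NeZero.ne M)
  rw [zmodBlock, val_zmodBlockGlue]
  have : (b.val * M + f.val) / M = b.val := by
    rw [mul_comm, Nat.mul_add_div hM, Nat.div_eq_of_lt hf, add_zero]
  rw [this, ZMod.natCast_zmod_val]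

/-- `(bM + f) mod M = f`. [folklore] -/
theorem zmodPos_glue (b : ZMod k) (f : ZMod M) : zmodPos k M (zmodBlockGlue k M b f) = f := by
  rw [zmodPos, ZMod.castHom_apply, ZMod.cast_eq_val, val_zmodBlockGlue]
  push_cast
  rw [ZMod.natCast_self, mul_zero, zero_add, ZMod.natCast_zmod_val]

/-- **No carry**: if the position of `z` is not the last one of its block, `z + 1` lies in the same
block. [folklore] -/
theorem zmodBlock_add_one_of_lt (z : ZMod (k * M)) (h : (zmodPos k M z).val + 1 < M) :
    zmodBlock k M (z + 1) = zmodBlock k M z := by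
  rw [zmodPos_val] at h
  have hz : z.val < k * M := ZMod.val_lt z
  have hM : 0 < M := Nat.pos_of_ne_zero (NeZero.ne M)
  set q := z.val / M with hq
  set r := z.val % M with hr
  have hzqr : z.val = q * M + r := by rw [hq, hr]; exact (Nat.div_add_mod' _ _).symm
  have hqk : q < k := Nat.div_lt_of_lt_mul (lt_of_lt_of_eq hz (Nat.mul_comm k M))
  have hlt : z.val + 1 < k * M := by
    have : (q + 1) * M ≤ k * M := Nat.mul_le_mul_right M hqk
    nlinarith
  have hne1 : k * M ≠ 1 := by
    intro h1
    have := (mul_eq_one.1 h1).2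
    omega
  have hval : (z + 1).val = z.val + 1 := by
    rw [ZMod.val_add, ZMod.val_one_eq_one_mod, Nat.one_mod_eq_one.2 hne1, Nat.mod_eq_of_lt hlt]
  rw [zmodBlock, zmodBlock, hval, hzqr]
  congr 1
  rw [add_assoc, mul_comm, Nat.mul_add_div hM, Nat.mul_add_div hM, Nat.div_eq_of_lt (by omega : r + 1 < M),
    Nat.div_eq_of_lt (by omega : r < M)]

end ZModBlocks

section TorusBlocks

variable (d k M : ℕ) [NeZero k] [NeZero M]

/-- **The block decomposition of the torus** `(ℤ/kMℤ)^d ≃ (ℤ/kℤ)^d × (ℤ/Mℤ)^d`: a site is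
(its block, its position inside the block), coordinatewise. Tasaki (2020) §2.2 (tensor-product
decomposition of the spin system over a partition of the sites). [folklore] -/
def torusBlockDecomp : TorusSite d (k * M) ≃ TorusSite d k × TorusSite d M where
  toFun x := (fun j => zmodBlock k M (x j), fun j => zmodPos k M (x j))
  invFun p := fun j => zmodBlockGlue k M (p.1 j) (p.2 j)
  left_inv x := by
    funext j
    exact zmodBlockGlue_block_pos (x j)
  right_inv p := by
    refine Prod.ext (funext fun j => ?_) (funext fun j => ?_)
    · exact zmodBlock_glue (p.1 j) (p.2 j)
    · exact zmodPos_glue (p.1 j) (p.2 j)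

variable {d k M}

/-- Block coordinates of a site. [folklore] -/
theorem torusBlockDecomp_apply_fst (x : TorusSite d (k * M)) (j : Fin d) :
    (torusBlockDecomp d k M x).1 j = zmodBlock k M (x j) := rfl

/-- Positions of a site inside its block. [folklore] -/
theorem torusBlockDecomp_apply_snd (x : TorusSite d (k * M)) (j : Fin d) :
    (torusBlockDecomp d k M x).2 j = zmodPos k M (x j) := rfl

/-- **A step inside a block**: if the position of `x` in direction `i` is not the last one,
`x + eᵢ` lies in the same block, at position `f + eᵢ`. [folklore] -/
theorem torusBlockDecomp_add_single (x : TorusSite d (k * M)) (i : Fin d)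
    (h : ((torusBlockDecomp d k M x).2 i).val + 1 < M) :
    torusBlockDecomp d k M (x + Pi.single i 1) =
      ((torusBlockDecomp d k M x).1, (torusBlockDecomp d k M x).2 + Pi.single i 1) := by
  rw [torusBlockDecomp_apply_snd] at h
  refine Prod.ext (funext fun j => ?_) (funext fun j => ?_)
  · rw [torusBlockDecomp_apply_fst, torusBlockDecomp_apply_fst, Pi.add_apply]
    by_cases hj : j = i
    · subst hj
      rw [Pi.single_eq_same]
      exact zmodBlock_add_one_of_lt (x j) h
    · rw [Pi.single_eq_of_ne hj, add_zero]
  · show zmodPos k M (x j + (Pi.single i (1 : ZMod (k * M)) : TorusSite d (k * M)) j) =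
      (torusBlockDecomp d k M x).2 j + (Pi.single i (1 : ZMod M) : TorusSite d M) j
    rw [map_add, torusBlockDecomp_apply_snd]
    by_cases hj : j = i
    · subst hj
      rw [Pi.single_eq_same, Pi.single_eq_same, map_one]
    · rw [Pi.single_eq_of_ne hj, Pi.single_eq_of_ne hj, map_zero]

end TorusBlocks

/-! ### Counting the boundary positions of a block -/

section Counting

variable {d M : ℕ} [NeZero M]

/-- In each direction `i`, at most `M^{d-1}` positions of the block `(ℤ/Mℤ)^d` are boundary
positions (last coordinate value `M - 1`): they are determined by their other `d - 1` coordinates.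
[folklore] -/
theorem card_filter_boundary_le (i : Fin d) :
    #{f : TorusSite d M | ¬ ((f i).val + 1 < M)} ≤ M ^ (d - 1) := by
  classical
  have hcard : Fintype.card ({j : Fin d // j ≠ i} → ZMod M) = M ^ (d - 1) := by
    rw [Fintype.card_fun, ZMod.card]
    congr 1
    rw [Fintype.card_subtype_compl, Fintype.card_fin, Fintype.card_subtype_eq]
  rw [← hcard, ← Finset.card_univ]
  refine Finset.card_le_card_of_injOn (fun f => fun j : {j : Fin d // j ≠ i} => f j.1)
    (fun _ _ => Finset.mem_univ _) ?_
  intro f hf g hg hfg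
  rw [Finset.coe_filter, Set.mem_setOf_eq] at hf hg
  have hfi : (f i).val = M - 1 := by have := ZMod.val_lt (f i); omega
  have hgi : (g i).val = M - 1 := by have := ZMod.val_lt (g i); omega
  funext j
  by_cases hj : j = i
  · subst hj
    exact ZMod.val_injective _ (hfi.trans hgi.symm)
  · exact congrFun hfg ⟨j, hj⟩

/-- Hence at most `d M^{d-1}` pairs `(f, i)` are boundary pairs. [folklore] -/
theorem sum_card_filter_boundary_le :
    ∑ i : Fin d, (#{f : TorusSite d M | ¬ ((f i).val + 1 < M)} : ℝ) ≤ d * (M : ℝ) ^ (d - 1) := by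
  calc ∑ i : Fin d, (#{f : TorusSite d M | ¬ ((f i).val + 1 < M)} : ℝ)
      ≤ ∑ _i : Fin d, ((M : ℝ) ^ (d - 1)) :=
        Finset.sum_le_sum fun i _ => by exact_mod_cast card_filter_boundary_le i
    _ = d * (M : ℝ) ^ (d - 1) := by
        rw [Finset.sum_const, Finset.card_univ, Fintype.card_fin, nsmul_eq_mul]

end Counting

end HeisenbergTL

/-! ### The tiling inequality -/

section Tiling

variable {d : ℕ}

namespace HeisenbergTL

/-- A normalised ground-state vector of a Hermitian matrix. [folklore] -/
theorem exists_unit_groundVector {m : Type*} [Fintype m] [DecidableEq m] [Nonempty m]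
    {A : Matrix m m ℂ} (hA : A.IsHermitian) :
    ∃ φ : m → ℂ, star φ ⬝ᵥ φ = 1 ∧ (star φ ⬝ᵥ (A *ᵥ φ)).re = A.groundEnergy := by
  obtain ⟨v, hvmem, hv0⟩ := Submodule.exists_mem_ne_zero_of_ne_bot
    (Matrix.groundSpace_ne_bot_holds hA)
  obtain ⟨c, -, -, hc1⟩ := EigenvalueContinuation.exists_normalize hv0
  exact ⟨(c : ℂ) • v, hc1,
    (Matrix.rayleigh_eq_groundEnergy_iff_holds hA _ hc1).2 (Submodule.smul_mem _ _ hvmem)⟩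

/-- **A bond inside one block of a block product state** has the expectation it has in the block
state: `⟨⨂φ, 𝐒_x·𝐒_y ⨂φ⟩ = ⟨φ, 𝐒_f·𝐒_g φ⟩` for `x, y` in the same block at positions `f ≠ g`
(`‖φ‖ = 1`). Tasaki (2020) §2.2. [folklore] -/
theorem blockProductState_expect_spinDot_same {Λ B F : Type*} [Fintype Λ] [DecidableEq Λ]
    [Fintype B] [DecidableEq B] [Fintype F] [DecidableEq F]
    (n : ℕ) (e : Λ ≃ B × F) (φ : TensorIndex F (n + 1) → ℂ) (hφ : star φ ⬝ᵥ φ = 1)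
    {x y : Λ} {b : B} {f g : F} (hx : e x = (b, f)) (hy : e y = (b, g)) (hxy : x ≠ y) (hfg : f ≠ g) :
    star (blockProductState e φ) ⬝ᵥ (spinDot n x y *ᵥ blockProductState e φ) =
      star φ ⬝ᵥ (spinDot n f g *ᵥ φ) := by
  rw [spinDot_eq_sum_mul_of_ne n hxy, spinDot_eq_sum_mul_of_ne n hfg, Matrix.sum_mulVec,
    Matrix.sum_mulVec, dotProduct_sum, dotProduct_sum]
  refine Finset.sum_congr rfl fun α _ => ?_
  simp only [siteSpin, ← Matrix.mulVec_mulVec]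
  rw [blockProductState_expect_onSite_onSite_same e φ hx hy, hφ, one_pow, mul_one]

end HeisenbergTL

open HeisenbergTL in
/-- **Tiling inequality for the Heisenberg antiferromagnet on tori** (`J ≥ 0`, spin `n/2`, any
`d`): for block side `M ≥ 3` and `k ≥ 1`,
`E₀((ℤ/kMℤ)^d) ≤ k^d (E₀((ℤ/Mℤ)^d) + 2 J S(S+1) d M^{d-1})`.
Proof: the block product `⨂_{blocks} φ_M` of the ground state of the `M`-torus is a trial state; a
bond inside a block contributes its block value, each of the `≤ d M^{d-1}` wrap-around / inter-block
bonds per block is bounded by `S(S+1)` in absolute value (Ruelle 1969 §2.2; Anderson 1951 for the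
variational use of product states). [folklore] -/
theorem heisenbergTorus_groundEnergy_tiling (n : ℕ) {J : ℝ} (hJ : 0 ≤ J) (k M : ℕ) [NeZero k]
    [NeZero M] (hM : 3 ≤ M) :
    (heisenbergHamiltonian n (torusGraph d (k * M)) J).groundEnergy ≤
      (k : ℝ) ^ d * ((heisenbergHamiltonian n (torusGraph d M) J).groundEnergy +
        2 * J * casimirValue n * d * (M : ℝ) ^ (d - 1)) := by
  haveI : Nonempty (TensorIndex (TorusSite d M) (n + 1)) := ⟨fun _ => 0⟩
  haveI : Nonempty (TensorIndex (TorusSite d (k * M)) (n + 1)) := ⟨fun _ => 0⟩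
  have hHM := heisenbergHamiltonian_isHermitian (Λ := TorusSite d M) n (torusGraph d M) J
  have hH := heisenbergHamiltonian_isHermitian (Λ := TorusSite d (k * M)) n (torusGraph d (k * M)) J
  obtain ⟨φ, hφ1, hφE⟩ := exists_unit_groundVector hHM
  have hΨ1 : star (blockProductState (torusBlockDecomp d k M) φ) ⬝ᵥ
      blockProductState (torusBlockDecomp d k M) φ = 1 := by
    rw [star_blockProductState_dotProduct_self, hφ1, one_pow]
  have hk : 1 ≤ k := Nat.pos_of_ne_zero (NeZero.ne k)
  have hkM : 3 ≤ k * M := le_trans hM (Nat.le_mul_of_pos_left M hk)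
  have hM2 : 2 ≤ M := by omega
  have hkM2 : 2 ≤ k * M := by omega
  have hvar := Matrix.groundEnergy_le_rayleigh_holds hH _ hΨ1
  rw [re_expect_heisenbergHamiltonian_torus n hkM J] at hvar
  -- the block comparison functions
  set t : TorusSite d M → Fin d → ℝ :=
    fun f i => (star φ ⬝ᵥ (spinDot n f (f + Pi.single i 1) *ᵥ φ)).re with ht
  set s : TorusSite d M → Fin d → ℝ :=
    fun f i => if (f i).val + 1 < M then t f i else casimirValue n with hs
  -- (1) every bond of the big torus is bounded by `s` at its block position
  have hbond : ∀ (x : TorusSite d (k * M)) (i : Fin d),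
      (star (blockProductState (torusBlockDecomp d k M) φ) ⬝ᵥ
        (spinDot n x (x + Pi.single i 1) *ᵥ blockProductState (torusBlockDecomp d k M) φ)).re ≤
        s (torusBlockDecomp d k M x).2 i := by
    intro x i
    simp only [hs]
    split_ifs with hgood
    · have hstep := torusBlockDecomp_add_single x i hgood
      have hx : torusBlockDecomp d k M x = ((torusBlockDecomp d k M x).1, (torusBlockDecomp d k M x).2) :=
        rfl
      have hfg : (torusBlockDecomp d k M x).2 ≠ (torusBlockDecomp d k M x).2 + Pi.single i 1 :=
        torusSite_ne_add_single hM2 _ i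
      rw [blockProductState_expect_spinDot_same n (torusBlockDecomp d k M) φ hφ1 hx hstep
        (torusSite_ne_add_single hkM2 x i) hfg]
    · have h := re_expect_spinDot_le n (torusSite_ne_add_single hkM2 x i)
        (blockProductState (torusBlockDecomp d k M) φ)
      rw [hΨ1, Complex.one_re, mul_one] at h
      exact h
  -- (2) the sum over the big torus is `k^d` copies of the block sum of `s`
  have hsum_le : ∑ x : TorusSite d (k * M), ∑ i : Fin d,
      (star (blockProductState (torusBlockDecomp d k M) φ) ⬝ᵥ
        (spinDot n x (x + Pi.single i 1) *ᵥ blockProductState (torusBlockDecomp d k M) φ)).re ≤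
      (k : ℝ) ^ d * ∑ f : TorusSite d M, ∑ i : Fin d, s f i := by
    calc ∑ x : TorusSite d (k * M), ∑ i : Fin d,
        (star (blockProductState (torusBlockDecomp d k M) φ) ⬝ᵥ
          (spinDot n x (x + Pi.single i 1) *ᵥ blockProductState (torusBlockDecomp d k M) φ)).re
        ≤ ∑ x : TorusSite d (k * M), ∑ i : Fin d, s (torusBlockDecomp d k M x).2 i :=
          Finset.sum_le_sum fun x _ => Finset.sum_le_sum fun i _ => hbond x i
      _ = ∑ p : TorusSite d k × TorusSite d M, ∑ i : Fin d, s p.2 i :=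
          (torusBlockDecomp d k M).sum_comp (fun p => ∑ i : Fin d, s p.2 i)
      _ = ∑ _b : TorusSite d k, ∑ f : TorusSite d M, ∑ i : Fin d, s f i :=
          Fintype.sum_prod_type _
      _ = (k : ℝ) ^ d * ∑ f : TorusSite d M, ∑ i : Fin d, s f i := by
          rw [Finset.sum_const, Finset.card_univ, Literature.MathematicalPhysics.QuantumLattice.card_torusSite, nsmul_eq_mul]
          push_cast
          ring
  -- (3) the block sum of `s` against the block energy
  have hEM : J * ∑ f : TorusSite d M, ∑ i : Fin d, t f i =
      (heisenbergHamiltonian n (torusGraph d M) J).groundEnergy := by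
    rw [← hφE, re_expect_heisenbergHamiltonian_torus n hM J φ]
  have hst : ∀ (f : TorusSite d M) (i : Fin d),
      s f i ≤ t f i + 2 * casimirValue n * (if ¬ ((f i).val + 1 < M) then 1 else 0) := by
    intro f i
    simp only [hs]
    split_ifs with hg
    · simp
    · have h := neg_re_expect_spinDot_le n (torusSite_ne_add_single hM2 f i) φ
      rw [hφ1, Complex.one_re, mul_one] at h
      simp only [ht]
      linarith
  have hbad : ∑ f : TorusSite d M, ∑ i : Fin d, (if ¬ ((f i).val + 1 < M) then (1 : ℝ) else 0) ≤
      d * (M : ℝ) ^ (d - 1) := by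
    rw [Finset.sum_comm]
    have hcnt : ∀ i : Fin d, ∑ f : TorusSite d M, (if ¬ ((f i).val + 1 < M) then (1 : ℝ) else 0) =
        (#{f : TorusSite d M | ¬ ((f i).val + 1 < M)} : ℝ) := by
      intro i
      rw [Finset.card_filter]
      push_cast
      rfl
    simp only [hcnt]
    exact sum_card_filter_boundary_le
  have h1 : ∑ f : TorusSite d M, ∑ i : Fin d, s f i ≤
      ∑ f : TorusSite d M, ∑ i : Fin d, t f i + 2 * casimirValue n *
        ∑ f : TorusSite d M, ∑ i : Fin d, (if ¬ ((f i).val + 1 < M) then (1 : ℝ) else 0) := by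
    rw [Finset.mul_sum, ← Finset.sum_add_distrib]
    refine Finset.sum_le_sum fun f _ => ?_
    rw [Finset.mul_sum, ← Finset.sum_add_distrib]
    exact Finset.sum_le_sum fun i _ => hst f i
  have hc := casimirValue_nonneg n
  have hblock : J * ∑ f : TorusSite d M, ∑ i : Fin d, s f i ≤
      (heisenbergHamiltonian n (torusGraph d M) J).groundEnergy +
        2 * J * casimirValue n * d * (M : ℝ) ^ (d - 1) := by
    have h2 := mul_le_mul_of_nonneg_left h1 hJ
    have h3 := mul_le_mul_of_nonneg_left hbad (mul_nonneg hJ hc)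
    rw [← hEM]
    nlinarith [h2, h3]
  -- (4) assemble
  have hkpos : (0 : ℝ) ≤ (k : ℝ) ^ d := by positivity
  calc (heisenbergHamiltonian n (torusGraph d (k * M)) J).groundEnergy
      ≤ J * ∑ x : TorusSite d (k * M), ∑ i : Fin d,
          (star (blockProductState (torusBlockDecomp d k M) φ) ⬝ᵥ
            (spinDot n x (x + Pi.single i 1) *ᵥ blockProductState (torusBlockDecomp d k M) φ)).re := hvar
    _ ≤ J * ((k : ℝ) ^ d * ∑ f : TorusSite d M, ∑ i : Fin d, s f i) :=
          mul_le_mul_of_nonneg_left hsum_le hJ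
    _ = (k : ℝ) ^ d * (J * ∑ f : TorusSite d M, ∑ i : Fin d, s f i) := by ring
    _ ≤ (k : ℝ) ^ d * ((heisenbergHamiltonian n (torusGraph d M) J).groundEnergy +
          2 * J * casimirValue n * d * (M : ℝ) ^ (d - 1)) :=
          mul_le_mul_of_nonneg_left hblock hkpos

end Tiling

/-! ### A small torus inside a large one: the filling inequality -/

namespace HeisenbergTL

section Extension

variable {X Y : Type*} [Fintype X] [DecidableEq X] [Fintype Y] [DecidableEq Y] {n : ℕ}

/-- **Extension of a state of a subsystem by the reference configuration outside.** For an
injection of sites `ι : X → Y` and a vector `φ` of the spin system on `X`, the vector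
`φ ⊗ |0…0⟩` of the spin system on `Y`: `σ ↦ φ(σ ∘ ι)` if `σ` vanishes off the range of `ι`, else `0`.
Tasaki (2020) §2.2 (tensor products in the configuration basis). [folklore] -/
def extendState (ι : X → Y) (φ : TensorIndex X (n + 1) → ℂ) : TensorIndex Y (n + 1) → ℂ :=
  fun σ => if (∀ y, (∀ x, ι x ≠ y) → σ y = 0) then φ (σ ∘ ι) else 0

/-- Reindexing the configurations vanishing off the range of `ι` by configurations of `X`.
[folklore] -/
theorem sum_ite_offRange_eq (ι : X → Y) (hι : Function.Injective ι)
    (g : TensorIndex X (n + 1) → ℂ) :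
    ∑ σ : TensorIndex Y (n + 1), (if (∀ y, (∀ x, ι x ≠ y) → σ y = 0) then g (σ ∘ ι) else 0) =
      ∑ τ : TensorIndex X (n + 1), g τ := by
  classical
  rw [← Finset.sum_filter]
  refine Finset.sum_nbij' (fun σ => σ ∘ ι) (fun τ => Function.extend ι τ 0) ?_ ?_ ?_ ?_ ?_
  · intro σ _; exact Finset.mem_univ _
  · intro τ _
    rw [Finset.mem_filter]
    refine ⟨Finset.mem_univ _, fun y hy => ?_⟩
    rw [Function.extend_apply' _ _ _ (fun ⟨x, hx⟩ => hy x hx)]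
    rfl
  · intro σ hσ
    rw [Finset.mem_filter] at hσ
    funext y
    by_cases h : ∃ x, ι x = y
    · obtain ⟨x, rfl⟩ := h
      exact hι.extend_apply _ _ x
    · rw [Function.extend_apply' _ _ _ h]
      push Not at h
      exact (hσ.2 y h).symm
  · intro τ _
    funext x
    exact hι.extend_apply _ _ x
  · intro σ _; rfl

/-- The extension is an isometry: `⟨φ ⊗ |0⟩, χ ⊗ |0⟩⟩ = ⟨φ, χ⟩`. [folklore] -/
theorem star_extendState_dotProduct (ι : X → Y) (hι : Function.Injective ι)
    (φ χ : TensorIndex X (n + 1) → ℂ) :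
    star (extendState ι φ) ⬝ᵥ extendState ι χ = star φ ⬝ᵥ χ := by
  simp only [dotProduct, Pi.star_apply, extendState]
  have : ∀ σ : TensorIndex Y (n + 1),
      star (if (∀ y, (∀ x, ι x ≠ y) → σ y = 0) then φ (σ ∘ ι) else 0) *
        (if (∀ y, (∀ x, ι x ≠ y) → σ y = 0) then χ (σ ∘ ι) else 0) =
      if (∀ y, (∀ x, ι x ≠ y) → σ y = 0) then (fun τ => star (φ τ) * χ τ) (σ ∘ ι) else 0 := by
    intro σ
    split_ifs <;> simp
  simp_rw [this]
  exact sum_ite_offRange_eq ι hι (fun τ => star (φ τ) * χ τ)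

/-- **A single-site operator at a site of the subsystem acts on the inner factor**:
`a_{ι x} (φ ⊗ |0⟩) = (a_x φ) ⊗ |0⟩`. Tasaki (2020) §2.2, eq. (2.2.5). [folklore] -/
theorem onSite_mulVec_extendState (ι : X → Y) (hι : Function.Injective ι) (x₀ : X)
    (a : Matrix (Fin (n + 1)) (Fin (n + 1)) ℂ) (φ : TensorIndex X (n + 1) → ℂ) :
    (onSite (ι x₀) a : Op Y (n + 1)) *ᵥ extendState ι φ = extendState ι (onSite x₀ a *ᵥ φ) := by
  funext σ
  rw [LiebMattis.onSite_mulVec_apply]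
  simp only [extendState]
  have hP : ∀ l : Fin (n + 1), (∀ y, (∀ x, ι x ≠ y) → Function.update σ (ι x₀) l y = 0) ↔
      (∀ y, (∀ x, ι x ≠ y) → σ y = 0) := by
    intro l
    refine forall_congr' fun y => ?_
    refine imp_congr_right fun hy => ?_
    rw [Function.update_of_ne (fun h => hy x₀ h.symm)]
  simp only [hP]
  by_cases h : ∀ y, (∀ x, ι x ≠ y) → σ y = 0
  · simp only [if_pos h, LiebMattis.onSite_mulVec_apply]
    refine Finset.sum_congr rfl fun l _ => ?_
    rw [Function.update_comp_eq_of_injective σ hι x₀ l]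
    rfl
  · simp only [if_neg h, mul_zero, Finset.sum_const_zero]

/-- **Two-site expectations inside the subsystem**: for `x ≠ y` in `X`,
`⟨φ ⊗ |0⟩, 𝐒_{ιx}·𝐒_{ιy} (φ ⊗ |0⟩)⟩ = ⟨φ, 𝐒_x·𝐒_y φ⟩`. Tasaki (2020) §2.2. [folklore] -/
theorem extendState_expect_spinDot (ι : X → Y) (hι : Function.Injective ι) {x y : X} (hxy : x ≠ y)
    (φ : TensorIndex X (n + 1) → ℂ) :
    star (extendState ι φ) ⬝ᵥ (spinDot n (ι x) (ι y) *ᵥ extendState ι φ) =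
      star φ ⬝ᵥ (spinDot n x y *ᵥ φ) := by
  rw [spinDot_eq_sum_mul_of_ne n (hι.ne hxy), spinDot_eq_sum_mul_of_ne n hxy, Matrix.sum_mulVec,
    Matrix.sum_mulVec, dotProduct_sum, dotProduct_sum]
  refine Finset.sum_congr rfl fun α _ => ?_
  simp only [siteSpin, ← Matrix.mulVec_mulVec]
  rw [onSite_mulVec_extendState ι hι, onSite_mulVec_extendState ι hι]
  exact star_extendState_dotProduct ι hι _ _

end Extension

/-! ### Small tori inside large tori: the filling inequality -/

section Filling

variable {d : ℕ}

/-- The map `(ℤ/ℓℤ)^d → (ℤ/Lℤ)^d`, `x ↦ (x mod ℓ, read in {0,…,ℓ-1}) mod L` coordinatewise; an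
injection for `ℓ ≤ L`. [folklore] -/
def torusCast (ℓ L : ℕ) (x : TorusSite d ℓ) : TorusSite d L := fun j => ((x j).val : ZMod L)

variable {ℓ L : ℕ} [NeZero ℓ]

/-- `torusCast` is injective for `ℓ ≤ L`. [folklore] -/
theorem torusCast_injective (hℓL : ℓ ≤ L) : Function.Injective (torusCast (d := d) ℓ L) := by
  intro x y hxy
  funext j
  have h := congrFun hxy j
  simp only [torusCast] at h
  have hx : (x j).val < L := lt_of_lt_of_le (ZMod.val_lt _) hℓL
  have hy : (y j).val < L := lt_of_lt_of_le (ZMod.val_lt _) hℓL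
  have := congrArg ZMod.val h
  rw [ZMod.val_cast_of_lt hx, ZMod.val_cast_of_lt hy] at this
  exact ZMod.val_injective _ this

/-- **A step inside the small torus**: if the `i`-th coordinate of `x` is not the last one,
`torusCast (x + eᵢ) = torusCast x + eᵢ`. [folklore] -/
theorem torusCast_add_single (L : ℕ) (x : TorusSite d ℓ) (i : Fin d)
    (h : (x i).val + 1 < ℓ) :
    torusCast ℓ L (x + Pi.single i 1) = torusCast ℓ L x + Pi.single i 1 := by
  have hne1 : ℓ ≠ 1 := by omega
  funext j
  simp only [torusCast, Pi.add_apply]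
  by_cases hj : j = i
  · subst hj
    rw [Pi.single_eq_same, Pi.single_eq_same, ZMod.val_add, ZMod.val_one_eq_one_mod,
      Nat.one_mod_eq_one.2 hne1, Nat.mod_eq_of_lt h]
    push_cast
    ring
  · rw [Pi.single_eq_of_ne hj, Pi.single_eq_of_ne hj, add_zero, add_zero]

/-- **The block comparison sum.** For a unit vector `φ` of the `M`-torus (`M ≥ 3`, `J ≥ 0`):
`J Σ_f Σᵢ s(f,i) ≤ ⟨φ, H_M φ⟩ + 2 J S(S+1) d M^{d-1}`, where `s(f,i)` is the bond expectation
`⟨φ, 𝐒_f·𝐒_{f+eᵢ} φ⟩` at interior pairs and `S(S+1)` at the `≤ d M^{d-1}` boundary pairs. [folklore] -/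
theorem block_comparison_sum_le (n : ℕ) {J : ℝ} (hJ : 0 ≤ J) (M : ℕ) [NeZero M] (hM : 3 ≤ M)
    (φ : TensorIndex (TorusSite d M) (n + 1) → ℂ) (hφ1 : star φ ⬝ᵥ φ = 1) :
    J * ∑ f : TorusSite d M, ∑ i : Fin d,
        (if (f i).val + 1 < M then (star φ ⬝ᵥ (spinDot n f (f + Pi.single i 1) *ᵥ φ)).re
          else casimirValue n) ≤
      (star φ ⬝ᵥ (heisenbergHamiltonian n (torusGraph d M) J *ᵥ φ)).re +
        2 * J * casimirValue n * d * (M : ℝ) ^ (d - 1) := by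
  have hM2 : 2 ≤ M := by omega
  rw [re_expect_heisenbergHamiltonian_torus n hM J φ]
  have hst : ∀ (f : TorusSite d M) (i : Fin d),
      (if (f i).val + 1 < M then (star φ ⬝ᵥ (spinDot n f (f + Pi.single i 1) *ᵥ φ)).re
          else casimirValue n) ≤
        (star φ ⬝ᵥ (spinDot n f (f + Pi.single i 1) *ᵥ φ)).re +
          2 * casimirValue n * (if ¬ ((f i).val + 1 < M) then 1 else 0) := by
    intro f i
    split_ifs with hg
    · simp
    · have h := neg_re_expect_spinDot_le n (torusSite_ne_add_single hM2 f i) φ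
      rw [hφ1, Complex.one_re, mul_one] at h
      linarith
  have hbad : ∑ f : TorusSite d M, ∑ i : Fin d, (if ¬ ((f i).val + 1 < M) then (1 : ℝ) else 0) ≤
      d * (M : ℝ) ^ (d - 1) := by
    rw [Finset.sum_comm]
    have hcnt : ∀ i : Fin d, ∑ f : TorusSite d M, (if ¬ ((f i).val + 1 < M) then (1 : ℝ) else 0) =
        (#{f : TorusSite d M | ¬ ((f i).val + 1 < M)} : ℝ) := by
      intro i
      rw [Finset.card_filter]
      push_cast
      rfl
    simp only [hcnt]
    exact sum_card_filter_boundary_le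
  have h1 : ∑ f : TorusSite d M, ∑ i : Fin d,
      (if (f i).val + 1 < M then (star φ ⬝ᵥ (spinDot n f (f + Pi.single i 1) *ᵥ φ)).re
          else casimirValue n) ≤
      ∑ f : TorusSite d M, ∑ i : Fin d, (star φ ⬝ᵥ (spinDot n f (f + Pi.single i 1) *ᵥ φ)).re +
        2 * casimirValue n *
          ∑ f : TorusSite d M, ∑ i : Fin d, (if ¬ ((f i).val + 1 < M) then (1 : ℝ) else 0) := by
    rw [Finset.mul_sum, ← Finset.sum_add_distrib]
    refine Finset.sum_le_sum fun f _ => ?_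
    rw [Finset.mul_sum, ← Finset.sum_add_distrib]
    exact Finset.sum_le_sum fun i _ => hst f i
  have hc := casimirValue_nonneg n
  have h2 := mul_le_mul_of_nonneg_left h1 hJ
  have h3 := mul_le_mul_of_nonneg_left hbad (mul_nonneg hJ hc)
  nlinarith [h2, h3]

end Filling

end HeisenbergTL

section FillingMain

variable {d ℓ L : ℕ} [NeZero ℓ]

open HeisenbergTL in
/-- **Filling inequality for the Heisenberg antiferromagnet on tori** (`J ≥ 0`, spin `n/2`):
for `3 ≤ ℓ ≤ L`, `E₀((ℤ/Lℤ)^d) ≤ E₀((ℤ/ℓℤ)^d) + J S(S+1) d (2ℓ^{d-1} + L^d - ℓ^d)`. Proof: the ground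
state of the small torus, placed on the sub-box `{0,…,ℓ-1}^d` of the large torus and extended by the
reference configuration outside, is a trial state; interior bonds of the sub-box contribute their
small-torus values, the `≤ dℓ^{d-1}` wrap-around bonds of the small torus and the `≤ d(L^d - ℓ^d)`
remaining bonds of the large torus are bounded by `S(S+1)` each (Ruelle 1969 §2.2). [folklore] -/
theorem heisenbergTorus_groundEnergy_filling [NeZero L] (n : ℕ) {J : ℝ} (hJ : 0 ≤ J) (hℓ : 3 ≤ ℓ)
    (hℓL : ℓ ≤ L) :
    (heisenbergHamiltonian n (torusGraph d L) J).groundEnergy ≤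
      (heisenbergHamiltonian n (torusGraph d ℓ) J).groundEnergy +
        J * casimirValue n * d * (2 * (ℓ : ℝ) ^ (d - 1) + ((L : ℝ) ^ d - (ℓ : ℝ) ^ d)) := by
  haveI : Nonempty (TensorIndex (TorusSite d ℓ) (n + 1)) := ⟨fun _ => 0⟩
  haveI : Nonempty (TensorIndex (TorusSite d L) (n + 1)) := ⟨fun _ => 0⟩
  have hL : 3 ≤ L := hℓ.trans hℓL
  have hℓ2 : 2 ≤ ℓ := by omega
  have hL2 : 2 ≤ L := by omega
  have hHl := heisenbergHamiltonian_isHermitian (Λ := TorusSite d ℓ) n (torusGraph d ℓ) J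
  have hH := heisenbergHamiltonian_isHermitian (Λ := TorusSite d L) n (torusGraph d L) J
  obtain ⟨φ, hφ1, hφE⟩ := exists_unit_groundVector hHl
  have hι := torusCast_injective (d := d) hℓL
  set Ψ := extendState (torusCast (d := d) ℓ L) φ with hΨ
  have hΨ1 : star Ψ ⬝ᵥ Ψ = 1 := by rw [hΨ, star_extendState_dotProduct _ hι, hφ1]
  have hvar := Matrix.groundEnergy_le_rayleigh_holds hH Ψ hΨ1
  rw [re_expect_heisenbergHamiltonian_torus n hL J Ψ] at hvar
  -- bonds of the large torus: inside the image of the small one, and outside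
  set r : TorusSite d L → ℝ :=
    fun y => ∑ i : Fin d, (star Ψ ⬝ᵥ (spinDot n y (y + Pi.single i 1) *ᵥ Ψ)).re with hr
  set I : Finset (TorusSite d L) := Finset.univ.image (torusCast (d := d) ℓ L) with hI
  have hrc : ∀ y, r y ≤ d * casimirValue n := by
    intro y
    simp only [hr]
    calc ∑ i : Fin d, (star Ψ ⬝ᵥ (spinDot n y (y + Pi.single i 1) *ᵥ Ψ)).re
        ≤ ∑ _i : Fin d, casimirValue n := Finset.sum_le_sum fun i _ => by
            have h := re_expect_spinDot_le n (torusSite_ne_add_single hL2 y i) Ψ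
            rw [hΨ1, Complex.one_re, mul_one] at h
            exact h
      _ = d * casimirValue n := by
            rw [Finset.sum_const, Finset.card_univ, Fintype.card_fin, nsmul_eq_mul]
  -- inside: bounded by the block comparison function of the small torus
  have hin : ∀ x : TorusSite d ℓ, r (torusCast ℓ L x) ≤ ∑ i : Fin d,
      (if (x i).val + 1 < ℓ then (star φ ⬝ᵥ (spinDot n x (x + Pi.single i 1) *ᵥ φ)).re
        else casimirValue n) := by
    intro x
    simp only [hr]
    refine Finset.sum_le_sum fun i _ => ?_
    split_ifs with hg
    · rw [← torusCast_add_single L x i hg, hΨ,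
        extendState_expect_spinDot _ hι (torusSite_ne_add_single hℓ2 x i)]
    · have h := re_expect_spinDot_le n (torusSite_ne_add_single hL2 (torusCast ℓ L x) i) Ψ
      rw [hΨ1, Complex.one_re, mul_one] at h
      exact h
  -- the split of the sum over the large torus
  have hsplit : ∑ y : TorusSite d L, r y = ∑ y ∈ I, r y + ∑ y ∈ Iᶜ, r y :=
    (Finset.sum_add_sum_compl I r).symm
  have hIsum : ∑ y ∈ I, r y = ∑ x : TorusSite d ℓ, r (torusCast ℓ L x) := by
    rw [hI, Finset.sum_image (fun x _ y _ h => hι h)]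
  have hcardI : (#Iᶜ : ℝ) = (L : ℝ) ^ d - (ℓ : ℝ) ^ d := by
    rw [Finset.card_compl, hI, Finset.card_image_of_injective _ hι, Finset.card_univ,
      Literature.MathematicalPhysics.QuantumLattice.card_torusSite, Literature.MathematicalPhysics.QuantumLattice.card_torusSite]
    have hle : ℓ ^ d ≤ L ^ d := Nat.pow_le_pow_left hℓL d
    push_cast [Nat.cast_sub hle]
    ring
  have hout : ∑ y ∈ Iᶜ, r y ≤ ((L : ℝ) ^ d - (ℓ : ℝ) ^ d) * (d * casimirValue n) := by
    calc ∑ y ∈ Iᶜ, r y ≤ ∑ _y ∈ Iᶜ, (d * casimirValue n : ℝ) := Finset.sum_le_sum fun y _ => hrc y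
      _ = ((L : ℝ) ^ d - (ℓ : ℝ) ^ d) * (d * casimirValue n) := by
          rw [Finset.sum_const, nsmul_eq_mul, hcardI]
  have hblock := block_comparison_sum_le n hJ ℓ hℓ φ hφ1
  rw [hφE] at hblock
  have hin' : ∑ x : TorusSite d ℓ, r (torusCast ℓ L x) ≤ ∑ x : TorusSite d ℓ, ∑ i : Fin d,
      (if (x i).val + 1 < ℓ then (star φ ⬝ᵥ (spinDot n x (x + Pi.single i 1) *ᵥ φ)).re
        else casimirValue n) := Finset.sum_le_sum fun x _ => hin x
  have hc := casimirValue_nonneg n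
  have hgap : (0 : ℝ) ≤ (L : ℝ) ^ d - (ℓ : ℝ) ^ d :=
    sub_nonneg.2 (pow_le_pow_left₀ (by positivity) (by exact_mod_cast hℓL) d)
  -- assemble
  have htot : J * ∑ y : TorusSite d L, r y ≤
      (heisenbergHamiltonian n (torusGraph d ℓ) J).groundEnergy +
        2 * J * casimirValue n * d * (ℓ : ℝ) ^ (d - 1) +
        J * (((L : ℝ) ^ d - (ℓ : ℝ) ^ d) * (d * casimirValue n)) := by
    rw [hsplit, hIsum, mul_add]
    have h2 := mul_le_mul_of_nonneg_left hin' hJ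
    have h3 := mul_le_mul_of_nonneg_left hout hJ
    linarith
  have hfinal : (heisenbergHamiltonian n (torusGraph d L) J).groundEnergy ≤ J * ∑ y : TorusSite d L, r y := by
    simpa only [hr] using hvar
  nlinarith [htot, hfinal, hgap, hc, hJ]

end FillingMain

end Literature.MathematicalPhysics.QuantumLattice
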